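import Summits.CriticalPhenomena.Ising3DConformalLimit.Theses.PerfectScreening
import Summits.CriticalPhenomena.Ising3DConformalLimit.Theses.EnergyNotSigmaSquared
import Summits.CriticalPhenomena.Ising3DConformalLimit.Theses.HyperoctahedralRP
import Summits.CriticalPhenomena.Ising3DConformalLimit.Theses.CurrentConnectionInvariance
import Summits.CriticalPhenomena.Ising3DConformalLimit.Theses.MirrorHoelderCompactness
import Summits.CriticalPhenomena.Ising3DConformalLimit.Theses.ClusterRigidity
import Summits.CriticalPhenomena.Ising3DConformalLimit.Theorems.PerfectScreeningMoebiusLimitExistsTwoLeaf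
import Summits.CriticalPhenomena.Ising3DConformalLimit.Theorems.HyperoctahedralRPInversionUpgradeNormalisedConditional
import Summits.CriticalPhenomena.Ising3DConformalLimit.Theorems.PerfectScreeningMoebiusLimitExistsSketchReduction
import Summits.CriticalPhenomena.Ising3DConformalLimit.Theorems.HyperoctahedralRPExistsScaleCovariantLimitFoldedCurrentUniqueness
import Literature.MathematicalPhysics.QuantumFieldTheory.PointwiseOSReconstruction
import HarnessLib

/-!
# Crux `MoebiusLimitExists` (stmt-CriticalPhenomena-1344) in LATTICE language: its leaves are
# `TwoPointDoubling` (stmt-6150), `ClusterSetTotallyDisconnected` (stmt-4659) and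
# `RatioInversionInvariance` (stmt-4840)

Route `PerfectScreening`, sub-problem `Ising3DConformalLimit`, line `Sketch` (lead
`prover-line-stmt-CriticalPhenomena-1344-c12-0`, HONEST-BET re-audit census).  Glue only, over
landed files; no definitions, no new mathematics — the point is to record, kernel-checked, what the
open load-bearing content of the crux IS after fourteen lead seats:

* `ratioInversionInvariance_of_MoebiusLimitExists` — the crux implies route
  `CurrentConnectionInvariance`'s crux `RatioInversionInvariance` (item stmt-4840: asymptotic
  inversion invariance of the weight-free lattice ratios `R^δ_n = G_n G_2 / G_{n+2}` of
  `criticalCorr 3`, i.e. of sourced double-current connection probabilities): a Möbius witness is an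
  inversion-covariant pointwise limit, and `tendsto_ratio_sub_of_isInversionCovariant` (landed,
  `…InversionUpgradeNormalisedConditional.lean`) turns that into the lattice statement.
* `MoebiusLimitExists_iff_existence_and_ratioInversionInvariance` —
  **crux ⟺ `ExistsScaleCovariantLimit` (stmt-1981) ∧ `RatioInversionInvariance` (stmt-4840)**:
  given existence, the conformal content of the conjecture is EXACTLY a lattice statement with no
  continuum covariance predicate in it (`⇐` is the landed bridge
  `InversionUpgradeNormalised_of_ratioInversionInvariance` composed with the two-leaf glue
  `MoebiusLimitExists_of_leaves`, p137285).
* `MoebiusLimitExists_iff_doubling_totallyDisconnected_ratio` —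
  **crux ⟺ `TwoPointDoubling` (stmt-6150) ∧ `ClusterSetTotallyDisconnected` (stmt-4659) ∧
  `RatioInversionInvariance` (stmt-4840)**, composing with crux stmt-1981's own landed factorisation
  `crux_iff_doubling_and_totallyDisconnected` (p139907): the crux as three statements about the
  critical lattice correlators and their rescalings only.
* `MoebiusLimitExists_iff_doubling_totallyDisconnected_interiorStrict` — the same with the third
  leaf in its continuum form, the registered stub 7′ `stub_interiorInversionUpgradeStrict` of line
  `Sketch` (⟺ item stmt-1982, `inversionUpgradeNormalised_iff_interiorStrict`, p139739).
* the `EnergyNotSigmaSquared.MoebiusLimit` spellings (same terms).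

References: Duminil-Copin, ICM 2022 §8.1/§8.4 (existence and rotation/conformal covariance of the
`ℤ³` limit are open); Aizenman–Duminil-Copin, Ann. Math. 194 (2021) §3.2 (sourced double currents,
the switching lemma behind `R^δ_n`); Di Francesco–Mathieu–Sénéchal 1997 §4.3.1 (Möbius covariance).
-/

noncomputable section

open Filter Topology
open Literature.Probability.LatticeModels Literature.MathematicalPhysics.QuantumFieldTheory
open EuclideanGeometry

namespace Summit.CriticalPhenomena.Ising3DConformalLimit.MoebiusLimitExistsLatticeLeaves

open Summit.CriticalPhenomena.Ising3DConformalLimit.Cruxes.InversionUpgradeNormalised.InversionDefectInvolution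
  (rescaledCorrelator_one tendsto_ratio_sub_of_isInversionCovariant
   InversionUpgradeNormalised_of_ratioInversionInvariance)
open Summit.CriticalPhenomena.Ising3DConformalLimit.MoebiusLimitExistsTwoLeaf
  (MoebiusLimitExists_of_leaves MoebiusLimitExists_iff_leaves)
open Summit.CriticalPhenomena.Ising3DConformalLimit.MoebiusLimitExistsSketch
  (MoebiusLimitExists_iff_existence_and_interiorStrict)
open Summit.CriticalPhenomena.Ising3DConformalLimit.Cruxes.ExistsScaleCovariantLimit.FoldedCurrentRepulsion
  (crux_iff_doubling_and_totallyDisconnected)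

/-- **The crux implies `RatioInversionInvariance` (item stmt-4840).**  A Möbius witness
`(ρ, Δ, S)` of `MoebiusLimitExists` is a non-degenerate pointwise scaling limit of `criticalCorr 3`
which is inversion covariant with weight `Δ`; by `tendsto_ratio_sub_of_isInversionCovariant` the
weight-free lattice ratios `R^δ_n` then satisfy `R^δ_n(ιx) − R^δ_n(x) → 0` as `δ → 0⁺` at every even
order `n` and every non-coincident configuration avoiding `0` (the Kelvin weights multiply up and
cancel).  So item stmt-4840 is NECESSARY for the crux. (Aizenman–Duminil-Copin, Ann. Math. 194
(2021), §3.2; Di Francesco–Mathieu–Sénéchal 1997, §4.3.1.) [folklore] -/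
theorem ratioInversionInvariance_of_MoebiusLimitExists
    (h : Theses.PerfectScreening.MoebiusLimitExists) :
    Theses.CurrentConnectionInvariance.RatioInversionInvariance := by
  obtain ⟨ρ, Δ, S, hρ, _, hlim, hnd, hM⟩ := h
  intro n hn _ x hx hx0
  simp only [rescaledCorrelator_one]
  exact tendsto_ratio_sub_of_isInversionCovariant hρ hlim hnd hM.isInversionCovariant hn hx hx0

/-- **Existence and the lattice ratio invariance give the crux**: item stmt-1981 and item
stmt-4840 imply `MoebiusLimitExists` — the landed bridge
`InversionUpgradeNormalised_of_ratioInversionInvariance` (4840 ⇒ 1982) composed with the two-leaf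
glue `MoebiusLimitExists_of_leaves` (1981 ⇒ 1982 ⇒ crux; item 1980 is the theorem
`LimitRotationInvariant_of`). [folklore] -/
theorem MoebiusLimitExists_of_existence_of_ratioInversionInvariance
    (h1981 : Theses.HyperoctahedralRP.ExistsScaleCovariantLimit)
    (h4840 : Theses.CurrentConnectionInvariance.RatioInversionInvariance) :
    Theses.PerfectScreening.MoebiusLimitExists :=
  MoebiusLimitExists_of_leaves h1981 (InversionUpgradeNormalised_of_ratioInversionInvariance h4840)

/-- **`MoebiusLimitExists ⟺ ExistsScaleCovariantLimit ∧ RatioInversionInvariance`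
(crux stmt-1344 ⟺ item stmt-1981 ∧ item stmt-4840).**  Given existence of the scale-covariant
limit, the conformal (inversion) content of the 3D-Ising conjecture is EXACTLY the asymptotic
inversion invariance of the weight-free lattice ratios of critical correlators — a statement about
`criticalCorr 3` alone, with no continuum covariance predicate.  Both leaves are open
(Duminil-Copin, ICM 2022, §8.4). [folklore] -/
theorem MoebiusLimitExists_iff_existence_and_ratioInversionInvariance :
    Summit.CriticalPhenomena.Ising3DConformalLimit.Theses.PerfectScreening.MoebiusLimitExists ↔
      Summit.CriticalPhenomena.Ising3DConformalLimit.Theses.HyperoctahedralRP.ExistsScaleCovariantLimit ∧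
        Summit.CriticalPhenomena.Ising3DConformalLimit.Theses.CurrentConnectionInvariance.RatioInversionInvariance :=
  ⟨fun h => ⟨(MoebiusLimitExists_iff_leaves.mp h).1, ratioInversionInvariance_of_MoebiusLimitExists h⟩,
    fun h => MoebiusLimitExists_of_existence_of_ratioInversionInvariance h.1 h.2⟩

/-- **The crux in lattice language: `MoebiusLimitExists ⟺ TwoPointDoubling ∧
ClusterSetTotallyDisconnected ∧ RatioInversionInvariance`** (crux stmt-1344 ⟺ item stmt-6150 ∧
item stmt-4659 ∧ item stmt-4840), composing the previous iff with crux stmt-1981's landed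
factorisation `crux_iff_doubling_and_totallyDisconnected` (all-scale doubling of the axial critical
two-point function ∧ total disconnectedness of the cluster set of the self-normalised rescaled
correlators).  Three open statements about the critical `ℤ³` correlators and their rescalings; each
is necessary. [folklore] -/
theorem MoebiusLimitExists_iff_doubling_totallyDisconnected_ratio :
    Summit.CriticalPhenomena.Ising3DConformalLimit.Theses.PerfectScreening.MoebiusLimitExists ↔
      Summit.CriticalPhenomena.Ising3DConformalLimit.Theses.MirrorHoelderCompactness.TwoPointDoubling ∧
        Summit.CriticalPhenomena.Ising3DConformalLimit.Theses.ClusterRigidity.ClusterSetTotallyDisconnected ∧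
          Summit.CriticalPhenomena.Ising3DConformalLimit.Theses.CurrentConnectionInvariance.RatioInversionInvariance := by
  rw [MoebiusLimitExists_iff_existence_and_ratioInversionInvariance,
    crux_iff_doubling_and_totallyDisconnected, and_assoc]

/-- **The crux as two lattice leaves and the registered stub 7′ of line `Sketch`:
`MoebiusLimitExists ⟺ TwoPointDoubling ∧ ClusterSetTotallyDisconnected ∧ Interior(<)`**, where
`Interior(<)` is `stub_interiorInversionUpgradeStrict` — the inversion upgrade on the interacting
stratum `U₄ ≢ 0` of the open window `1/2 < Δ ≤ 3/4` with the pointwise OS premises along the three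
axes and clustering supplied as hypotheses (⟺ item stmt-1982 by
`inversionUpgradeNormalised_iff_interiorStrict`).  Composition of
`MoebiusLimitExists_iff_existence_and_interiorStrict` (p139739) with
`crux_iff_doubling_and_totallyDisconnected` (p139907). [folklore] -/
theorem MoebiusLimitExists_iff_doubling_totallyDisconnected_interiorStrict :
    Theses.PerfectScreening.MoebiusLimitExists ↔
      Theses.MirrorHoelderCompactness.TwoPointDoubling ∧
        Theses.ClusterRigidity.ClusterSetTotallyDisconnected ∧
      (∀ (ρ : ℝ → ℝ) (Δ : ℝ) (S : CorrFamily 3), (∀ δ ∈ Set.Ioc (0:ℝ) 1, 0 < ρ δ) →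
        HasPointwiseScalingLimit (criticalCorr 3) ρ S → (∀ n z, z ∉ NonCoincident 3 n → S n z = 0) →
        IsNondegenerateTwoPoint S → IsEuclideanInvariant S → IsScaleCovariant Δ S →
        1 / 2 < Δ → Δ ≤ 3 / 4 → HasNontrivialU4 S →
        (∀ τ : Fin 3, PointwiseOSReconstruction τ S) →
        (∀ (n m : ℕ) (x : Fin n → EuclideanSpace ℝ (Fin 3)) (y : Fin m → EuclideanSpace ℝ (Fin 3))
          (v : EuclideanSpace ℝ (Fin 3)), v ≠ 0 →
          Tendsto (fun t : ℝ => S (n + m) (Fin.append x (fun j => y j + t • v)) - S n x * S m y)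
            atTop (𝓝 0)) →
        IsInversionCovariant Δ S) := by
  rw [MoebiusLimitExists_iff_existence_and_interiorStrict, crux_iff_doubling_and_totallyDisconnected,
    and_assoc]

/-- **Given the two lattice leaves of existence, item stmt-4840 and stub 7′ are interchangeable**:
under `TwoPointDoubling ∧ ClusterSetTotallyDisconnected` (⟺ item stmt-1981),
`RatioInversionInvariance ⟺ Interior(<)` — both are then equivalent to the crux. [folklore] -/
theorem ratioInversionInvariance_iff_interiorStrict_of_latticeLeaves
    (hD : Theses.MirrorHoelderCompactness.TwoPointDoubling)
    (hT : Theses.ClusterRigidity.ClusterSetTotallyDisconnected) :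
    Theses.CurrentConnectionInvariance.RatioInversionInvariance ↔
      (∀ (ρ : ℝ → ℝ) (Δ : ℝ) (S : CorrFamily 3), (∀ δ ∈ Set.Ioc (0:ℝ) 1, 0 < ρ δ) →
        HasPointwiseScalingLimit (criticalCorr 3) ρ S → (∀ n z, z ∉ NonCoincident 3 n → S n z = 0) →
        IsNondegenerateTwoPoint S → IsEuclideanInvariant S → IsScaleCovariant Δ S →
        1 / 2 < Δ → Δ ≤ 3 / 4 → HasNontrivialU4 S →
        (∀ τ : Fin 3, PointwiseOSReconstruction τ S) →
        (∀ (n m : ℕ) (x : Fin n → EuclideanSpace ℝ (Fin 3)) (y : Fin m → EuclideanSpace ℝ (Fin 3))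
          (v : EuclideanSpace ℝ (Fin 3)), v ≠ 0 →
          Tendsto (fun t : ℝ => S (n + m) (Fin.append x (fun j => y j + t • v)) - S n x * S m y)
            atTop (𝓝 0)) →
        IsInversionCovariant Δ S) := by
  constructor
  · intro h4840
    exact ((MoebiusLimitExists_iff_doubling_totallyDisconnected_interiorStrict.mp
      (MoebiusLimitExists_iff_doubling_totallyDisconnected_ratio.mpr ⟨hD, hT, h4840⟩)).2).2
  · intro h7
    exact ((MoebiusLimitExists_iff_doubling_totallyDisconnected_ratio.mp
      (MoebiusLimitExists_iff_doubling_totallyDisconnected_interiorStrict.mpr ⟨hD, hT, h7⟩)).2).2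

/-- The primary route's spelling: **`EnergyNotSigmaSquared.MoebiusLimit ⟺ ExistsScaleCovariantLimit ∧
RatioInversionInvariance`** (same term as `MoebiusLimitExists`). [folklore] -/
theorem MoebiusLimit_iff_existence_and_ratioInversionInvariance :
    Theses.EnergyNotSigmaSquared.MoebiusLimit ↔
      Theses.HyperoctahedralRP.ExistsScaleCovariantLimit ∧
        Theses.CurrentConnectionInvariance.RatioInversionInvariance :=
  MoebiusLimitExists_iff_existence_and_ratioInversionInvariance

/-- The primary route's spelling: **`EnergyNotSigmaSquared.MoebiusLimit ⟺ TwoPointDoubling ∧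
ClusterSetTotallyDisconnected ∧ RatioInversionInvariance`**. [folklore] -/
theorem MoebiusLimit_iff_doubling_totallyDisconnected_ratio :
    Theses.EnergyNotSigmaSquared.MoebiusLimit ↔
      Theses.MirrorHoelderCompactness.TwoPointDoubling ∧
        Theses.ClusterRigidity.ClusterSetTotallyDisconnected ∧
          Theses.CurrentConnectionInvariance.RatioInversionInvariance :=
  MoebiusLimitExists_iff_doubling_totallyDisconnected_ratio

end Summit.CriticalPhenomena.Ising3DConformalLimit.MoebiusLimitExistsLatticeLeaves

end
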